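import Literature.RepresentationTheory.BorelWallach2000.UpqConjugateModule
import Literature.NumberTheory.Automorphic.GKModules
import HarnessLib

/-!
# FLOOR-0 P3b «ENGINE local packets», line `F0_LocalAPackets` — STUB T3a₅ CLOSED: conjugation flips the degree-one type
# `H¹_δ(V) ≠ 0 ⇒ H¹_{−δ}(V^c) ≠ 0` (Borel–Wallach II §4.2: `𝔭⁺` and `𝔭⁻` are complex conjugates of each other)

Cell hodgecm-mathlib (D-0151), FLOOR 0, crux item H413 = stmt-HodgeConjecture-24833; sub-line
`Cruxes/H413/Lines/F0_LocalAPackets.lean` (F0P3b-plan (g4), edition 1, commit 2a4b8a813d3e), registered stub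
`stub_T3aConjTypeFlip : StubT3aConjTypeFlip` (§2 there, brief B5).  PROOF lane (theorems only); author B-p08 (g17).
Per the cell's stub-closer protocol (director s347) the Lines module is NOT imported: the TYPE of `stubT3aConjTypeFlip_holds`
(§2) is the body of `…Cruxes.H413.F0LocalAPackets.StubT3aConjTypeFlip` BINDER FOR BINDER, and the by-name fold
`theorem stub_T3aConjTypeFlip : StubT3aConjTypeFlip := F0P3bStubT3aConjTypeFlip.stubT3aConjTypeFlip_holds` goes into the
line at its next edition.

Content.  For a `(𝔤, K)`-module `(ρK, ρ𝔤)` of `U(α, β)` on `V` and its CONJUGATE module `V^c = (ρK ∘ σ, ρ𝔤 ∘ σ)`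
(`UpqConj.kAct`, `UpqConj.lieAct`; `σ` = entrywise complex conjugation, ★ `upqConjLie_upqZ0 : σ z₀ = −z₀`), the tree's ★
change-of-pair isomorphism `UpqConj.cohomologyEquiv n : H^n(𝔤, K; V^c) ≃ₗ[ℂ] H^n(𝔤, K; V)` maps the type-`δ` classes
`H^n_δ(V^c)` ONTO `H^n_{−δ}(V)` (★ `UpqConj.cohomologyEquiv_symm_mem_upqTypeClasses`, ★ `UpqConj.typeClassesEquiv`;
[BorelWallach2000, II §4.2 (3), Thm. 4.8]).  Hence (§1, all degrees `n`, ANY two `Ad`-compatibility witnesses — the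
type subspaces do not depend on the witness) `H^n_δ(V) ≠ 0 ↔ H^n_{−δ}(V^c) ≠ 0`, and (§2) the registered statement at
`n = 1` with the witnesses `h.ad_compat`, `hc.ad_compat` of the line's two `IsGKModule` hypotheses.  In Rogawski's
notation this is `J⁺ ↔ J⁻` under `ξ(b, a, c) ↔ ξ(a, c, b)` [Rogawski1990, §12.3 p. 178].

HC_CM is proved only modulo the 7 printed citations until rung 0 closes; this closes ONE generic stub (T3a₅) of ONE
floor-0 sub-line.

## References
* [BorelWallach2000] A. Borel, N. Wallach, *Continuous Cohomology, Discrete Subgroups, and Representations of Reductive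
  Groups*, 2nd ed., AMS 2000 — I §5.1 (4) (functoriality in the pair), II §4.2 (3), Thm. 4.8.
* [Rogawski1990] J. Rogawski, *Automorphic Representations of Unitary Groups in Three Variables*, Ann. of Math. Stud. 123
  (1990) — §12.3 p. 178.
-/

-- Mathlib idiom (as in `GKModules`, the `Upq*` files and the line): commutator bracket on `Module.End`
attribute [local instance 100] LieRing.ofAssociativeRing

set_option autoImplicit false
set_option linter.dupNamespace false

noncomputable section

namespace Summit.HodgeConjecture.HodgeConjecture.Cruxes.H413.F0P3bStubT3aConjTypeFlip

open Literature.NumberTheory.Automorphic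
open Literature.RepresentationTheory.BorelWallach2000
open Literature.RepresentationTheory.KonnoKonno2007 Literature.RepresentationTheory.KonnoKonno2007.RealDualPair
open Literature.RepresentationTheory.KonnoKonno2007.RealDualPair.UForm

/-! ## §1 Generic, all degrees: `H^n_δ(V) ≠ 0 → H^n_{−δ}(V^c) ≠ 0` and the `iff` -/

section Generic

variable {α β : Type*} [Fintype α] [DecidableEq α] [Fintype β] [DecidableEq β]
  {V : Type*} [AddCommGroup V] [Module ℂ V]
  (ρK : Representation ℂ (uFormGroup α β).maximalCompact V)
  (ρ𝔤 : (uFormGroup α β).lie →ₗ⁅ℝ⁆ Module.End ℂ V)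
  (hV : ∀ (k : (uFormGroup α β).maximalCompact) (X : (uFormGroup α β).lie), ρK k ∘ₗ ρ𝔤 X ∘ₗ ρK k⁻¹ =
    ρ𝔤 ((uFormGroup α β).Ad (Subgroup.inclusion (uFormGroup α β).maximalCompact_le_carrier k) X))
  (hc : ∀ (k : (uFormGroup α β).maximalCompact) (X : (uFormGroup α β).lie),
    UpqConj.kAct ρK k ∘ₗ UpqConj.lieAct ρ𝔤 X ∘ₗ UpqConj.kAct ρK k⁻¹ =
      UpqConj.lieAct ρ𝔤 ((uFormGroup α β).Ad (Subgroup.inclusion (uFormGroup α β).maximalCompact_le_carrier k) X))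

/-- **A non-zero type-`δ` class of `V` gives a non-zero type-`(−δ)` class of the conjugate module `V^c`** (any degree `n`,
any `Ad`-compatibility witness `hc` for `V^c` — by proof irrelevance the type subspace is the one built on ★ `UpqConj.had`):
the inverse of the tree's ★ `UpqConj.cohomologyEquiv` is injective and maps `H^n_δ(V)` into `H^n_{−δ}(V^c)`
(★ `UpqConj.cohomologyEquiv_symm_mem_upqTypeClasses`). [cite: BorelWallach2000, II §4.2 (3), Thm. 4.8] -/
theorem upqTypeClasses_conj_neg_ne_bot {n : ℕ} {δ : ℤ} (hne : upqTypeClasses ρK ρ𝔤 hV n δ ≠ ⊥) :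
    upqTypeClasses (UpqConj.kAct ρK) (UpqConj.lieAct ρ𝔤) hc n (-δ) ≠ ⊥ := by
  obtain ⟨y, hy, hy0⟩ := (Submodule.ne_bot_iff _).1 hne
  refine (Submodule.ne_bot_iff _).2 ⟨(UpqConj.cohomologyEquiv ρK ρ𝔤 hV n).symm y, ?_, ?_⟩
  · exact UpqConj.cohomologyEquiv_symm_mem_upqTypeClasses ρK ρ𝔤 hV hy
  · exact fun h0 => hy0 ((LinearEquiv.map_eq_zero_iff _).1 h0)

/-- **Conversely, a non-zero type-`δ` class of `V^c` gives a non-zero type-`(−δ)` class of `V`**: the ★ isomorphism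
`UpqConj.cohomologyEquiv` itself maps `H^n_δ(V^c)` into `H^n_{−δ}(V)` (★ `UpqConj.cohomologyEquiv_mem_upqTypeClasses`).
[cite: BorelWallach2000, II §4.2 (3), Thm. 4.8] -/
theorem upqTypeClasses_neg_ne_bot_of_conj {n : ℕ} {δ : ℤ}
    (hne : upqTypeClasses (UpqConj.kAct ρK) (UpqConj.lieAct ρ𝔤) hc n δ ≠ ⊥) :
    upqTypeClasses ρK ρ𝔤 hV n (-δ) ≠ ⊥ := by
  obtain ⟨x, hx, hx0⟩ := (Submodule.ne_bot_iff _).1 hne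
  refine (Submodule.ne_bot_iff _).2 ⟨UpqConj.cohomologyEquiv ρK ρ𝔤 hV n x, ?_, ?_⟩
  · exact UpqConj.cohomologyEquiv_mem_upqTypeClasses ρK ρ𝔤 hV hx
  · exact fun h0 => hx0 ((LinearEquiv.map_eq_zero_iff _).1 h0)

/-- **`H^n_{−δ}(V^c) ≠ 0 ↔ H^n_δ(V) ≠ 0`** — the types `(p, q) ↔ (q, p)` are exchanged under conjugation, at the level of
non-vanishing. [cite: BorelWallach2000, II §4.2 (3), Thm. 4.8] -/
theorem upqTypeClasses_conj_neg_ne_bot_iff (n : ℕ) (δ : ℤ) :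
    upqTypeClasses (UpqConj.kAct ρK) (UpqConj.lieAct ρ𝔤) hc n (-δ) ≠ ⊥ ↔ upqTypeClasses ρK ρ𝔤 hV n δ ≠ ⊥ := by
  refine ⟨fun h => ?_, upqTypeClasses_conj_neg_ne_bot ρK ρ𝔤 hV hc⟩
  have h' := upqTypeClasses_neg_ne_bot_of_conj ρK ρ𝔤 hV hc h
  rwa [neg_neg] at h'

end Generic

/-! ## §2 The registered stub T3a₅, BINDER FOR BINDER -/

/-- **STUB T3a₅ `StubT3aConjTypeFlip` CLOSED** — the body of `…Cruxes.H413.F0LocalAPackets.StubT3aConjTypeFlip` VERBATIM as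
the type: for every `(𝔤, K)`-module of `U(α, β)` (`IsGKModule` for `V` and for `V^c`) and every `δ : ℤ`, a non-zero degree-one
class of type `δ` on `V` gives a non-zero degree-one class of type `−δ` on the conjugate module `V^c`.  The line folds
`stub_T3aConjTypeFlip := stubT3aConjTypeFlip_holds` by name. [cite: BorelWallach2000, II §4.2 (3); Rogawski1990, §12.3 p. 178] -/
theorem stubT3aConjTypeFlip_holds :
    ∀ (α β : Type) [Fintype α] [DecidableEq α] [Fintype β] [DecidableEq β]
      (V : Type) [AddCommGroup V] [Module ℂ V]
      (ρK : Representation ℂ (uFormGroup α β).maximalCompact V) (ρ𝔤 : (uFormGroup α β).lie →ₗ⁅ℝ⁆ Module.End ℂ V)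
      (h : IsGKModule (uFormGroup α β) ρK ρ𝔤) (hc : IsGKModule (uFormGroup α β) (UpqConj.kAct ρK) (UpqConj.lieAct ρ𝔤))
      (δ : ℤ), upqTypeClasses ρK ρ𝔤 h.ad_compat 1 δ ≠ ⊥ →
        upqTypeClasses (UpqConj.kAct ρK) (UpqConj.lieAct ρ𝔤) hc.ad_compat 1 (-δ) ≠ ⊥ :=
  fun _ _ _ _ _ _ _ _ _ ρK ρ𝔤 h hc _ hne => upqTypeClasses_conj_neg_ne_bot ρK ρ𝔤 h.ad_compat hc.ad_compat hne

end Summit.HodgeConjecture.HodgeConjecture.Cruxes.H413.F0P3bStubT3aConjTypeFlip
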